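import Summits.HodgeConjecture.HodgeConjecture.Theorems.F0P3bKTypeIntegrationGK
import Summits.HodgeConjecture.HodgeConjecture.Theorems.F0P3bKovacevicTransports
import Summits.HodgeConjecture.HodgeConjecture.Theorems.F0P3bArchDegOnePackageDefs
import Literature.RepresentationTheory.BorelWallach2000.GKCohomologyCentralCharacter
import Literature.RepresentationTheory.Kovacevic2021.SU21Unitarity
import Summits.HodgeConjecture.HodgeConjecture.Theorems.K2E1bKTypeTwistDefs
import Summits.HodgeConjecture.HodgeConjecture.Theorems.K2E1bKovLieTwist   -- ★ PAID socket #3 (p854802, K2E1b-p01) — re-tie by import (ED. 3)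
import Summits.HodgeConjecture.HodgeConjecture.Theorems.K2E1bDatumTwistActs   -- ★ PAID socket #4 (★, K2E1b-p02) — re-tie by import (ED. 3)
import Summits.HodgeConjecture.HodgeConjecture.Theorems.K2E1bKTypeTwistGK   -- ★ PAID socket #5 (★, K2E1b-p03) — re-tie by import (ED. 3)
import Summits.HodgeConjecture.HodgeConjecture.Theorems.K2E1bTwistAdmissible   -- ★ PAID socket #6 (K2E1b-p04) — re-tie by import (ED. 4)
import Summits.HodgeConjecture.HodgeConjecture.Theorems.K2E1bTwistHermitian   -- ★ PAID socket #8 (K2E1b-p06) — re-tie by import (ED. 4)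
import Summits.HodgeConjecture.HodgeConjecture.Theorems.K2E1bTwistIrreducible   -- ★ PAID socket #9 (K2E1b-p07) — re-tie by import (ED. 4)
import Summits.HodgeConjecture.HodgeConjecture.Theorems.K2E1bTwistChiScalars   -- ★ PAID socket #7 (p854816, K2E1b-p05) — re-tie by import (ED. 5)
import Summits.HodgeConjecture.HodgeConjecture.Theorems.K2E1bDatumCohUnitaryIrrep   -- ★ PAID socket #10 (p854937, K2E1b-p08) — re-tie by import (ED. 5)

/-!
# K2 ∕ E1b tier 1 · unit U0 «TWIST INTEGRATION» — `K`-integration of Kovačević's `K`-type modules WITH A CENTRAL CHARACTER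
# (sockets `sig_K2E1b*` for the planned files `Theorems/K2E1b<Camel>.lean`; CHAIR ORDERS #1–#2, K2-lead (g0))

Tier-1 socket module `Cruxes/H413/Lines/K2_E1b_GKCohomologyU21_U0_TwistIntegration.lean` (flat name: the gate's `crux write` grammar admits no
`Lines/<dir>/<file>`; ORDER #2's `K2_<E>_<Name>/<Unit>` is rendered `K2_<E>_<Name>_<Unit>`) of the tier-0 line
`Cruxes/H413/Lines/K2_E1b_GKCohomologyU21.lean` (ns `…Cruxes.H413.K2E1bGKCohomologyU21`; stubs «J-TABLE», «DS-TABLE», «WIGNER»).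
Item h413 = stmt-HodgeConjecture-24833; author K2E1b-plan (g0).  Imports ★ only (the tier-0 module is cited by name, not imported:
its three χ-predicates `HasChiScalars` ∕ `IsChiPinnedCohUnitary` ∕ `NoDegOneClass` appear below UNFOLDED, token for token).
HONEST LABEL: HC_CM is proved only modulo the 7 printed citations (2 remaining named inputs: hLiu418 = stmt-HodgeConjecture-24832,
h413 = stmt-HodgeConjecture-24833) until rung 0 closes; this module proves nothing (every `sig_` is a `sorry`d socket).

WHY THIS UNIT.  ★ `isGKModule_kTypeRep` integrates Kovačević's `u`-basis formulas to a `(𝔲(2,1), K)`-module ONLY when the centre of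
`𝔤𝔩(3)` acts by `0` (★ `SU21Datum.ρfun_one`) and `6 ∣ m − 3n + 3` — i.e. only for the TRIVIAL central character.  Rogawski's table
[§12.3 p. 178] needs `J^±_φ`, `D_φ`, `π²_φ` for EVERY `φ = (a,b,c)`, whose centre `i·1 ∈ 𝔲(2,1)` acts by `i·e(φ)`, `e = a+b+c`
(`= centralExp`, tier 0).  U0 supplies the CENTRAL TWIST: the Lie action `σ = kovLie ρ + (e∕3)·tr(·)·1` (`IsTwistOf`), the twisted
`u`-basis formulas (`ActsOnKTypesTwist`, the ★ `ActsOnKTypes` body + `(e∕3)·tr(X)·u^k`), the twisted `K`-action `det^{a'} u^{b'} Sym^{n−1}`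
with `a' = (m − 3n + 3 + 2e)∕6`, `b' = (e − m)∕3` (integral iff `6 ∣ m − 3n + 3 + 2e`), its `(𝔤,K)`-structure, admissibility, χ-scalars
(trace-form Casimir `κ₀ + e²∕3` — calibrated on ★ `upqDetChar m`: `3m²` with `e = 3m`, `κ₀ = 0`), the invariant Hermitian form
(the twist is purely imaginary on `𝔲(2,1)`), irreducibility transport, and the per-datum packaging `IsCohUnitaryIrrep` + χ-scalars.
DEFS: `IsTwistOf`, `ActsOnKTypesTwist` are ★ `Theorems/K2E1bKTypeTwistDefs.lean` (p854741, commit 6b3d521692d0; ED. 2; K2-lead R3 (d) ∕ R6 ∕ R7 «DEFS BEFORE SIGS»).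
[cite: BorelWallach2000, 0 §2.5; VI §4 4.7–4.8] [cite: Kovacevic2021, §3 Def. 1, Thm. 2–3; §4 Thm. 4] [cite: Rogawski1990, §12.3 pp. 176–178]
-/

set_option autoImplicit false
set_option linter.dupNamespace false

noncomputable section

/-! ED. 5 — ALL EIGHT U0 SOCKETS ★ PAID (re-tied by import, statement bytes frozen): #3 `sig_K2E1bKovLieTwist` (p854802, K2E1b-p01), #4 `sig_K2E1bDatumTwistActs`
(K2E1b-p02), #5 `sig_K2E1bKTypeTwistGK` (K2E1b-p03), #6 `sig_K2E1bTwistAdmissible` (K2E1b-p04), #7 `sig_K2E1bTwistChiScalars` (p854816, K2E1b-p05), #8 `sig_K2E1bTwistHermitian`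
(K2E1b-p06), #9 `sig_K2E1bTwistIrreducible` (K2E1b-p07), #10 `sig_K2E1bDatumCohUnitaryIrrep` (p854937, K2E1b-p08); 0 sorries. -/

namespace Summit.HodgeConjecture.HodgeConjecture.Cruxes.H413.K2E1bGKCohomologyU21.U0

open Literature.NumberTheory.Automorphic
open Literature.RepresentationTheory.BorelWallach2000
open Literature.RepresentationTheory.KonnoKonno2007 Literature.RepresentationTheory.KonnoKonno2007.RealDualPair
open Literature.RepresentationTheory.KonnoKonno2007.RealDualPair.UForm
open Literature.RepresentationTheory.Kovacevic2021 Literature.RepresentationTheory.Kovacevic2021.SU21Datum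
open Summit.HodgeConjecture.HodgeConjecture.Cruxes.H413.F0P3bLocalAPacketsDefs
open Summit.HodgeConjecture.HodgeConjecture.Cruxes.H413.F0P3bU21Restriction
open Summit.HodgeConjecture.HodgeConjecture.Cruxes.H413.F0P3bKTypeIntegration (KIdx kvec kTypeRep ActsOnKTypes)
open Summit.HodgeConjecture.HodgeConjecture.Cruxes.H413.F0P3bArchDegOnePackage (IsCohUnitaryIrrep IsUnitaryAlongP)

-- Mathlib idiom (as in `GKModules`, the `Upq*` files, the Kovačević topic): commutator bracket on `Module.End` ∕ matrices
attribute [local instance 100] LieRing.ofAssociativeRing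

/-! ## §0 `IsTwistOf`, `ActsOnKTypesTwist` — NOW ★ `Theorems/K2E1bKTypeTwistDefs.lean` (p854741; ED. 2, K2-lead R6∕R7; bodies moved VERBATIM, parent namespace, so every statement below is byte-identical to ed. 1) -/

/-! ## §1 Sockets (one per planned file; each `sorry` is the file's target) -/

/-- **FILE `Theorems/K2E1bKovLieTwist.lean` (size S).**  The central twist exists as a real Lie homomorphism `𝔲(2,1) → End V` for every
`𝔤𝔩(3, ℂ)`-module `ρ` and every `z ∈ ℂ`: `X ↦ kovLie ρ X + z·tr(X)·1` respects brackets since `tr [X,Y] = 0` and scalars are central.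
[Rogawski1990 §12.3 p. 177] [KnappVogan1995 Prop. 4.120]  audit: R90 p0167.txt:L33–35 «the center of the enveloping algebra of G acts by the same
character by which it acts on F_φ».  deps: ★ F0P3bU21Restriction (`kovLie`, `kovLie_apply`), Mathlib `Matrix.trace_mul_comm`.  FIRST RUNG.
[cite: Rogawski1990, §12.3 p. 177] [cite: KnappVogan1995, Prop. 4.120] -/
theorem sig_K2E1bKovLieTwist :
    ∀ (V : Type) [AddCommGroup V] [Module ℂ V] (ρ : Matrix (Fin 3) (Fin 3) ℂ →ₗ⁅ℂ⁆ Module.End ℂ V) (z : ℂ),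
      ∃ σ : G21.lie →ₗ⁅ℝ⁆ Module.End ℂ V, IsTwistOf ρ z σ :=
  Summit.HodgeConjecture.HodgeConjecture.Cruxes.H413.K2E1bKovLieTwist.kovLieTwist  -- ★ PAID (p854802, K2E1b-p01): re-tied by import (ED. 3)

/-- **FILE `Theorems/K2E1bDatumTwistActs.lean` (size M).**  For EVERY Kovačević datum `𝒟` and every `e`, the twist `σ` of `𝒟.ρ` by `e∕3`
acts on the basis `u^k_{n,m}` by the twisted `u`-basis formulas on `𝔨` — read off ★ `SU21Datum.ρfun` on block-diagonal matrices exactly as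
★ `F0P3bKTypeIntegrationGK` §3 does for `ladderPlus` (there with `e = 0`), plus the scalar `(e∕3)·tr(X)`.
[Kovacevic2021 §3 Def. 1] [BorelWallach2000 VI §4 4.7–4.8]  audit: Kovačević §3 Def. 1 is ★ `SU21ModulesFromKTypes` (kernel-checked source;
no page file) — AUDIT = decl `SU21Datum.ρfun` L825–827.  deps: ★ SU21ModulesFromKTypes (`ρfun`, `op_vec`), ★ F0P3bKTypeIntegrationGK §3 (`actsOnKTypes` pattern), ★ F0P3bU21Coordinates.
[cite: Kovacevic2021, §3 Def. 1] [cite: BorelWallach2000, VI §4 4.7–4.8] -/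
theorem sig_K2E1bDatumTwistActs :
    ∀ (𝒟 : SU21Datum) (e : ℤ) (σ : G21.lie →ₗ⁅ℝ⁆ Module.End ℂ 𝒟.V),
      IsTwistOf 𝒟.ρ ((e : ℂ) / 3) σ → ActsOnKTypesTwist 𝒟.S e σ :=
  Summit.HodgeConjecture.HodgeConjecture.Cruxes.H413.K2E1bDatumTwistActs.DatumTwistActs  -- ★ PAID (★, K2E1b-p02): re-tied by import (ED. 3)

/-- **FILE `Theorems/K2E1bKTypeTwistGK.lean` (size L; carries the defs leaf `Theorems/K2E1bKTypeTwistDefs.lean`: `kTypeMatTwist e n m g :=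
(cnorm i ∕ cnorm l) · upqKTypeCoeff (n−1) ((m − 3n + 3 + 2e)∕6) ((e − m)∕3) g l i`, `kTypeRepTwist S e`).**  TWISTED `K`-INTEGRATION: if `1 ≤ n`
and `6 ∣ m − 3n + 3 + 2e` on `S` and `ρ𝔤|_𝔨` acts by the twisted formulas, then SOME `K`-action preserving every `K`-type `V_{n,m}` makes
`(ρK, ρ𝔤)` a `(𝔤, K)`-module of `U(2,1)` (★ `isGKModule_kTypeRep` is the case `e = 0`; same proof with the exponents shifted by `e∕3`:
the derivative of `det(g₁₁)^{a'} u^{b'}` along `X ∈ 𝔨` is `a'·tr X₁₁ + b'·x₂₂ = [★ terms] + (e∕3)·tr X`).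
WHY IT MIGHT FAIL: only the integrality bookkeeping (`a', b' ∈ ℤ` ⇔ `6 ∣ m − 3n + 3 + 2e`, which implies `3 ∣ e − m`).
[BorelWallach2000 0 §2.5; VI §4 4.7–4.8] [Kovacevic2021 §6]  audit: BW p0169.txt:L5–6 «(11) … H^q(𝔤,K;V) = Hom_K(Λ^q 𝔭, V)» (the (𝔤,K)-module frame of VI §4).
deps: ★ F0P3bKTypeCalculus (`upqKTypeCoeff*`, `hasDerivAt_upqKTypeCoeff_expK`), ★ F0P3bKTypeIntegration(GK) (verbatim pattern), ★ GKModulesAdCompatOfWeakDeriv.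
[cite: BorelWallach2000, 0 §2.5; VI §4 4.7–4.8] [cite: Kovacevic2021, §3 Def. 1; §6] -/
theorem sig_K2E1bKTypeTwistGK :
    ∀ (S : Set (ℤ × ℤ)) (e : ℤ), (∀ n m : ℤ, (n, m) ∈ S → 1 ≤ n ∧ (6 : ℤ) ∣ m - 3 * n + 3 + 2 * e) →
      ∀ (ρ𝔤 : (uFormGroup (Fin 2) (Fin 1)).lie →ₗ⁅ℝ⁆ Module.End ℂ (KIdx S →₀ ℂ)), ActsOnKTypesTwist S e ρ𝔤 →
        ∃ ρK : Representation ℂ (uFormGroup (Fin 2) (Fin 1)).maximalCompact (KIdx S →₀ ℂ),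
          IsGKModule (uFormGroup (Fin 2) (Fin 1)) ρK ρ𝔤 ∧
            ∀ (g : (uFormGroup (Fin 2) (Fin 1)).maximalCompact) (n m k : ℤ),
              ρK g (kvec S n m k) ∈ Submodule.span ℂ (Set.range fun l : ℤ => kvec S n m l) :=
  Summit.HodgeConjecture.HodgeConjecture.Cruxes.H413.K2E1bKTypeTwistGK.KTypeTwistGK  -- ★ PAID (★, K2E1b-p03): re-tied by import (ED. 3)

/-- **FILE `Theorems/K2E1bTwistAdmissible.lean` (size M).**  A `K`-type-preserving `(𝔤, K)`-structure with the twisted `𝔨`-formulas is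
ADMISSIBLE: `K = U(2) × U(1)` is connected, so `ρK|V_{n,m} = det^{a'} u^{b'} Sym^{n−1}` is irreducible of highest weight determined by
`(n, a', b')`, and `(n, m) ↦ (n, a', b')` is injective for fixed `e` — every `K`-isotypic component is one `V_{n,m}` (finite-dimensional).
(★ `isAdmissibleGK_kovLie_of_weightBasis` is the `e = 0` route via `Z`-weights; either road.)
[BorelWallach2000 0 §2.4–2.5] [KnappVogan1995 §I.3]  audit: BW p0169.txt:L10–11 «4.12 … (2) the representations … are unitary» frame; admissibility is 0 §2.5 (no page file: TOC p0005).
deps: ★ GKModulesAdmissible (`IsAdmissibleGK` API, `isAdmissibleGK_of_*`), ★ F0P3bKovLieTransports (`isAdmissibleGK_kovLie_of_weightBasis`).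
[cite: BorelWallach2000, 0 §2.5] [cite: KnappVogan1995, §I.3] -/
theorem sig_K2E1bTwistAdmissible :
    ∀ (S : Set (ℤ × ℤ)) (e : ℤ) (ρK : Representation ℂ (uFormGroup (Fin 2) (Fin 1)).maximalCompact (KIdx S →₀ ℂ))
      (ρ𝔤 : (uFormGroup (Fin 2) (Fin 1)).lie →ₗ⁅ℝ⁆ Module.End ℂ (KIdx S →₀ ℂ)),
      (∀ n m : ℤ, (n, m) ∈ S → 1 ≤ n) → IsGKModule (uFormGroup (Fin 2) (Fin 1)) ρK ρ𝔤 → ActsOnKTypesTwist S e ρ𝔤 →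
        (∀ (g : (uFormGroup (Fin 2) (Fin 1)).maximalCompact) (n m k : ℤ),
          ρK g (kvec S n m k) ∈ Submodule.span ℂ (Set.range fun l : ℤ => kvec S n m l)) →
        IsAdmissibleGK ρK :=
  Summit.HodgeConjecture.HodgeConjecture.Cruxes.H413.K2E1bTwistAdmissible.twistAdmissible  -- ★ PAID (★, K2E1b-p04): re-tied by import (ED. 4)

/-- **FILE `Theorems/K2E1bTwistChiScalars.lean` (size M).**  χ-SCALARS OF A TWIST: if Kovačević's trace-form Casimir `Σ ρ(E_ij) ρ(E_ji)`
(= ★ `SU21Datum.casimir`, spelled with the `𝔤𝔩(3, ℂ)`-brackets `Σ_{ij} ⁅E_ij, ⁅E_ji, v⁆⁆` so that only built modules are imported) acts on `𝒟.V` by `κ₀`, then on the twist `σ` by `e∕3` the tree's trace-form Casimir ★ `upqCasimirOp σ` acts by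
`κ₀ + e²∕3` (cross terms vanish since `Σ_i ρ(E_ii) = ρ(1) = 0`, ★ `ρfun_one`; `3·(e∕3)² = e²∕3`) and every `Z` with matrix `i·1` acts by `e·i`
(the second clause is VERBATIM the centre clause of tier 0's `HasChiScalars σ _ e`).  CALIBRATION (first `example` of the file): `trivialMod`
twisted by `e = 3m` gives `3m²` = ★ `upqDetChar_casimir`; `ladderPlus`, `e = 0` gives `0`.
WHY IT MIGHT FAIL: the normalisation of ★ `upqCasimirOp` vs `Σ E_ij E_ji` (★ `UpqCasimirStandardCalibration`, ★ `SU21CasimirCentral.casimir_eq_casimirOp` fix it).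
[BorelWallach2000 II §2.3, Prop. 6.12 (2)] [Rogawski1990 §12.3 p. 177]  audit: R90 p0167.txt:L33–35 (centre of the enveloping algebra acts as on F_φ).
deps: ★ UpqCasimirTensor (`upqCasimirOp_eq`), ★ UpqCasimirStandardCalibration, ★ SU21CasimirCentral (`casimir_eq_casimirOp`), ★ UpqDeterminantCharacter.
[cite: BorelWallach2000, II §2.3; II Prop. 6.12 (2)] [cite: Rogawski1990, §12.3 p. 177] -/
theorem sig_K2E1bTwistChiScalars :
    ∀ (𝒟 : SU21Datum) (e : ℤ) (κ₀ : ℂ), (∀ v : 𝒟.V, (∑ i : Fin 3, ∑ j : Fin 3, ⁅E i j, ⁅E j i, v⁆⁆) = κ₀ • v) →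
      ∀ (σ : G21.lie →ₗ⁅ℝ⁆ Module.End ℂ 𝒟.V), IsTwistOf 𝒟.ρ ((e : ℂ) / 3) σ →
        (∀ v : 𝒟.V, upqCasimirOp σ v = (κ₀ + (e : ℂ) ^ 2 / 3) • v) ∧
          ∀ Z : G21.lie, (Z : Matrix (Fin 2 ⊕ Fin 1) (Fin 2 ⊕ Fin 1) ℂ) = Complex.I • (1 : Matrix (Fin 2 ⊕ Fin 1) (Fin 2 ⊕ Fin 1) ℂ) →
            ∀ v : 𝒟.V, σ Z v = ((e : ℂ) * Complex.I) • v :=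
  Summit.HodgeConjecture.HodgeConjecture.Cruxes.H413.K2E1bTwistChiScalars.twistChiScalars  -- ★ PAID (p854816, K2E1b-p05): re-tied by import (ED. 5)

/-- **FILE `Theorems/K2E1bTwistHermitian.lean` (size M).**  UNITARITY SURVIVES THE TWIST: Kovačević's positive-definite sign-skew Hermitian form
(★ `IsUnitarizable 𝒟`, §4 Thm. 4) is invariant for the twisted `𝔲(2,1)`-action — ★ `hasInvariantHermitianForm_kovLie_of_signSkew` handles
`kovLie 𝒟.ρ`, and the twist adds `(e∕3)·tr(X)·1` with `tr X ∈ iℝ` for `X ∈ 𝔲(2,1)`, a purely imaginary scalar, hence `H`-skew.  Then ★ T3a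
(`stubT3aUnitaryAlongPOfHermitian_holds`) gives `IsUnitaryAlongP σ`.
[Kovacevic2021 §4 Thm. 4] [BorelWallach2000 VI Thm. 4.12 (2)]  audit: BW p0169.txt:L10–11 «4.12 Theorem … (2) … unitary».
deps: ★ F0P3bU21Restriction (`hasInvariantHermitianForm_kovLie_of_signSkew`, `star_reindex_apply`), ★ SU21Unitarity, ★ F0P3bStubT3aUnitaryAlongPOfHermitian.
[cite: Kovacevic2021, §4 Thm. 4] [cite: BorelWallach2000, VI Thm. 4.12 (2)] -/
theorem sig_K2E1bTwistHermitian :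
    ∀ (𝒟 : SU21Datum) (e : ℤ) (σ : G21.lie →ₗ⁅ℝ⁆ Module.End ℂ 𝒟.V),
      IsTwistOf 𝒟.ρ ((e : ℂ) / 3) σ → IsUnitarizable 𝒟 → HasInvariantHermitianForm σ :=
  Summit.HodgeConjecture.HodgeConjecture.Cruxes.H413.K2E1bTwistHermitian.twistHermitian  -- ★ PAID (★, K2E1b-p06): re-tied by import (ED. 4)

/-- **FILE `Theorems/K2E1bTwistIrreducible.lean` (size M).**  IRREDUCIBILITY SURVIVES THE TWIST: an irreducible `𝔤𝔩(3, ℂ)`-datum with ANY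
compatible `K`-action is an irreducible `(𝔤, K)`-module for the twisted action — a `(𝔤, K)`-submodule is stable under `σ(X) − (e∕3)tr(X)·1 =
kovLie ρ X`, hence under the complex span `𝔤𝔩(3, ℂ)` (★ `upq_isIrreducibleGK_of_lieModule_isIrreducible` is the `e = 0` case; its hypothesis
`ρ𝔤 X v = ⁅e X, v⁆` becomes `… + scalar • v`, one extra line).
[Kovacevic2021 §3 Thm. 3] [BorelWallach2000 0 §2.5]  audit: Kovačević Thm. 3 irreducibility is ★ `SU21Irreducible`∕`SU21PrincipalSeriesReducibility` (kernel-checked source).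
deps: ★ UpqComplexSpan (`upq_isIrreducibleGK_of_lieModule_isIrreducible`, `upq_complexSpan`), ★ F0P3bKovacevicTransports (pattern `irredAdm_of_isGKModule`).
[cite: Kovacevic2021, §3 Thm. 3] [cite: BorelWallach2000, 0 §2.5] -/
theorem sig_K2E1bTwistIrreducible :
    ∀ (𝒟 : SU21Datum) (e : ℤ) (σ : G21.lie →ₗ⁅ℝ⁆ Module.End ℂ 𝒟.V), IsTwistOf 𝒟.ρ ((e : ℂ) / 3) σ →
      LieModule.IsIrreducible ℂ (Matrix (Fin 3) (Fin 3) ℂ) 𝒟.V →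
        ∀ ρK : Representation ℂ G21.maximalCompact 𝒟.V, IsGKModule G21 ρK σ → IsIrreducibleGK ρK σ :=
  Summit.HodgeConjecture.HodgeConjecture.Cruxes.H413.K2E1bTwistIrreducible.TwistIrreducible  -- ★ PAID (★, K2E1b-p07): re-tied by import (ED. 4)

/-- **FILE `Theorems/K2E1bDatumCohUnitaryIrrep.lean` (size M; the per-datum PACKAGING both tables use).**  An irreducible unitarizable Kovačević
datum with constant Casimir `κ₀` and `6 ∣ m − 3n + 3 + 2e` on its `K`-types carries, for the twist by `e∕3`, a `K`-action making it an
irreducible admissible `(𝔲(2,1), K)`-module unitary along `𝔭 ⊕ ℝz₀` (★ `IsCohUnitaryIrrep`) with χ-scalars `(κ₀ + e²∕3, e)` — the conjunction of the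
six sockets above + ★ T3a.  Its last two clauses are VERBATIM tier 0's `HasChiScalars σ κ e` once `κ₀ + e²∕3 = κ` is an integer.
[Rogawski1990 §12.3 pp. 176–177; Prop. 13.8.1] [BorelWallach2000 VI Thm. 4.12 (2)] [Kovacevic2021 §3–§4]  audit: R90 p0167.txt:L27–35.
deps: the six U0 sockets, ★ F0P3bStubT3aUnitaryAlongPOfHermitian, ★ F0P3bArchDegOnePackageDefs (`IsCohUnitaryIrrep.mk`).
[cite: Rogawski1990, §12.3 pp. 176–177] [cite: BorelWallach2000, VI Thm. 4.12 (2)] [cite: Kovacevic2021, §3 Thm. 3; §4 Thm. 4] -/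
theorem sig_K2E1bDatumCohUnitaryIrrep :
    ∀ (𝒟 : SU21Datum) (e : ℤ) (κ₀ : ℂ), LieModule.IsIrreducible ℂ (Matrix (Fin 3) (Fin 3) ℂ) 𝒟.V → IsUnitarizable 𝒟 →
      (∀ v : 𝒟.V, (∑ i : Fin 3, ∑ j : Fin 3, ⁅E i j, ⁅E j i, v⁆⁆) = κ₀ • v) →
      (∀ n m : ℤ, (n, m) ∈ 𝒟.S → (6 : ℤ) ∣ m - 3 * n + 3 + 2 * e) →
        ∃ (ρK : Representation ℂ G21.maximalCompact 𝒟.V) (σ : G21.lie →ₗ⁅ℝ⁆ Module.End ℂ 𝒟.V),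
          IsTwistOf 𝒟.ρ ((e : ℂ) / 3) σ ∧ IsCohUnitaryIrrep ρK σ ∧
            (∀ v : 𝒟.V, upqCasimirOp σ v = (κ₀ + (e : ℂ) ^ 2 / 3) • v) ∧
              ∀ Z : G21.lie, (Z : Matrix (Fin 2 ⊕ Fin 1) (Fin 2 ⊕ Fin 1) ℂ) = Complex.I • (1 : Matrix (Fin 2 ⊕ Fin 1) (Fin 2 ⊕ Fin 1) ℂ) →
                ∀ v : 𝒟.V, σ Z v = ((e : ℂ) * Complex.I) • v :=
  Summit.HodgeConjecture.HodgeConjecture.Cruxes.H413.K2E1bDatumCohUnitaryIrrep.DatumCohUnitaryIrrep  -- ★ PAID (p854937, K2E1b-p08): re-tied by import (ED. 5)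

end Summit.HodgeConjecture.HodgeConjecture.Cruxes.H413.K2E1bGKCohomologyU21.U0

end
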